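import Literature.AlgebraicGeometry.Resolution.RegularLocalRingsNormal
import Mathlib.RingTheory.MvPolynomial.Homogeneous
import Mathlib.Algebra.MvPolynomial.Monad
import HarnessLib

/-!
# NRA-A run reading, FILE 3b: **homogeneous lifts from the residue field and the congruence modulo `𝔪^(d+1)`**
# (pure local algebra; Theses-free, def-free)

OURS (campaign `res-hironaka`, rung L ★L-G4, slot W4.1 · crux `Steer` (stmt-ResolutionOfSingularities-16345) · hARᵒ H2, residue word NRA-A; RULING
284(b)(3); plan `D/res-D-repro-2/NRA-A-RUNREADING-PLAN.md` FILE 3 step (c); seat res-D-repro-2 g9). Over Literature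
`eval_mem_pow_succ_of_map_residue_eq_zero` (RegularLocalRingsNormal). Not a statement of the manuscript under review [claim: Hironaka2017, status:
under-review]; AI-produced, weaker than expert review.

* `exists_isHomogeneous_lift` — a form over the residue field `κ(S)` lifts to a form of the same degree over the local ring `S`.
* `isHomogeneous_bind₁_of_linear` — substituting LINEAR forms into a form of degree `d` gives a form of degree `d`.
* `eval_sub_eval_bind₁_mem_pow_succ` — THE CONGRUENCE: if `Φ` (form of degree `d` over `S`, `𝔪_S = (z)`) reduces to `H̄(M̄₁,…,M̄_m)` with linear
  forms `M̄_i` and a form `H̄` over `κ(S)`, then for homogeneous lifts `M_i`, `H`: `Φ(z) − H(M₁(z),…,M_m(z)) ∈ 𝔪_S^(d+1)` — the shape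
  `s² − g² − Ψ(m₁, m₂) ∈ 𝔪^(d+1)` of `BinaryAxisDatumAt` with `m_i := M_i(z)`, `Ψ := H`.
[folklore]
-/

noncomputable section

set_option linter.dupNamespace false

open MvPolynomial IsLocalRing

namespace Summit.ResolutionOfSingularities.ResolutionOfSingularities.Theorems.SwitchingDichotomy.NonRationalWindow

open Literature.AlgebraicGeometry.Resolution

/-- **Homogeneous lift from the residue field.** [folklore] -/
theorem exists_isHomogeneous_lift {S : Type*} [CommRing S] [IsLocalRing S] {τ : Type*} {n : ℕ}
    (P : MvPolynomial τ (ResidueField S)) (hP : P.IsHomogeneous n) :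
    ∃ Q : MvPolynomial τ S, Q.IsHomogeneous n ∧ MvPolynomial.map (residue S) Q = P := by
  classical
  -- lift coefficientwise on the support
  choose lift hlift using fun c : ResidueField S => residue_surjective (R := S) c
  refine ⟨∑ α ∈ P.support, monomial α (lift (coeff α P)), ?_, ?_⟩
  · refine IsHomogeneous.sum _ _ _ fun α hα => isHomogeneous_monomial _ ?_
    have := hP (mem_support_iff.mp hα)
    rwa [Finsupp.degree_eq_weight_one]
  · rw [map_sum]
    conv_rhs => rw [P.as_sum]
    refine Finset.sum_congr rfl fun α _ => ?_
    rw [map_monomial, hlift]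

/-- **Substituting linear forms into a form of degree `d` gives a form of degree `d`.** [folklore] -/
theorem isHomogeneous_bind₁_of_linear {A : Type*} [CommRing A] {σ τ : Type*} {d : ℕ} {H : MvPolynomial σ A} (hH : H.IsHomogeneous d)
    {M : σ → MvPolynomial τ A} (hM : ∀ i, (M i).IsHomogeneous 1) : (bind₁ M H).IsHomogeneous d := by
  classical
  rw [show bind₁ M H = ∑ β ∈ H.support, C (coeff β H) * ∏ i ∈ β.support, M i ^ β i by
    conv_lhs => rw [H.as_sum]
    rw [map_sum]
    refine Finset.sum_congr rfl fun β _ => ?_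
    rw [bind₁_monomial]]
  refine IsHomogeneous.sum _ _ _ fun β hβ => ?_
  have hdeg : ∑ i ∈ β.support, 1 * β i = d := by
    have := hH (mem_support_iff.mp hβ)
    rw [← this, Finsupp.weight_apply, Finsupp.sum]
    simp [mul_comm]
  have hprod : (∏ i ∈ β.support, M i ^ β i).IsHomogeneous (∑ i ∈ β.support, 1 * β i) :=
    IsHomogeneous.prod _ _ _ fun i _ => (hM i).pow (β i)
  rw [hdeg] at hprod
  simpa using (isHomogeneous_C _ (coeff β H)).mul hprod

/-- **The congruence modulo `𝔪^(d+1)`.** See the module docstring. [folklore] -/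
theorem eval_sub_eval_bind₁_mem_pow_succ {S : Type*} [CommRing S] [IsLocalRing S] {k : ℕ} (z : Fin k → S)
    (hz : Ideal.span (Set.range z) = maximalIdeal S) {σ : Type*} {d : ℕ}
    {Φ : MvPolynomial (Fin k) S} (hΦ : Φ.IsHomogeneous d)
    {M : σ → MvPolynomial (Fin k) S} (hM : ∀ i, (M i).IsHomogeneous 1) {H : MvPolynomial σ S} (hH : H.IsHomogeneous d)
    (hred : MvPolynomial.map (residue S) Φ =
      bind₁ (fun i => MvPolynomial.map (residue S) (M i)) (MvPolynomial.map (residue S) H)) :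
    MvPolynomial.eval z Φ - MvPolynomial.eval (fun i => MvPolynomial.eval z (M i)) H ∈ maximalIdeal S ^ (d + 1) := by
  classical
  have hbind : (bind₁ M H).IsHomogeneous d := isHomogeneous_bind₁_of_linear hH hM
  have hmap : MvPolynomial.map (residue S) (Φ - bind₁ M H) = 0 := by
    rw [map_sub, map_bind₁, hred, sub_self]
  have heval : MvPolynomial.eval z (bind₁ M H) = MvPolynomial.eval (fun i => MvPolynomial.eval z (M i)) H := by
    rw [show MvPolynomial.eval z = eval₂Hom (RingHom.id S) z from rfl, eval₂Hom_bind₁]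
    rfl
  have := eval_mem_pow_succ_of_map_residue_eq_zero z hz (hΦ.sub hbind) hmap
  rwa [map_sub, heval] at this

end Summit.ResolutionOfSingularities.ResolutionOfSingularities.Theorems.SwitchingDichotomy.NonRationalWindow

end
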